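import Mathlib.LinearAlgebra.Lagrange
import Mathlib.LinearAlgebra.Vandermonde
import Mathlib.LinearAlgebra.Matrix.Block
import Mathlib.Analysis.Calculus.IteratedDeriv.Lemmas
import Mathlib.Analysis.Calculus.ContDiff.Deriv
import Mathlib.Analysis.Calculus.ContDiff.Polynomial
import Mathlib.Analysis.Calculus.Deriv.Polynomial
import Mathlib.Analysis.Calculus.LocalExtr.Rolle
import Mathlib.Algebra.Ring.Int.Units
import HarnessLib

/-!
# Interpolation determinants: the generalized mean value bound

The inequality behind the determinant method of Bombieri–Pila (formula (1) of
[BombieriPila1989], going back to H. A. Schwarz and to Swinnerton-Dyer's Lemma 1): for nodes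
`x 0 < x 1 < ⋯ < x (n-1)` and functions `f j ∈ C^{n-1}`,
`|det (f j (x i))| ≤ V(x) · ∑_σ ∏_i K (σ i) i` whenever `|f_j^{(m)}| ≤ m! K m j` on
`[x 0, x (n-1)]`, where `V(x) = ∏_i ∏_{l<i} (x_i - x_l)` is the (absolute value of the)
Vandermonde determinant (`abs_det_le`).

## Proof

Newton interpolation: with `f[x_0, …, x_k]` the `k`-th divided difference (defined here as the
leading coefficient of the Lagrange interpolation polynomial at `x_0, …, x_k`, `newtonCoeff`),
Newton's form `f(x_i) = ∑_m f[x_0..x_m] ∏_{l<m} (x_i - x_l)` (`apply_node_eq_sum`) factors the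
matrix `(f_j(x_i))` as `L · D` with `L` lower triangular of determinant `V(x)` and
`D m j = f_j[x_0..x_m]`, and the mean value theorem for divided differences
(`exists_newtonCoeff_eq`: `f[x_0..x_k] = f^{(k)}(ξ)/k!`, from the generalized Rolle theorem
`exists_iteratedDeriv_eq_zero`) bounds the entries of `D`.

## References

* E. Bombieri, J. Pila, *The number of integral points on arcs and ovals*, Duke Math. J. 59
  (1989) 337–357, formula (1) and Proposition 2 [BombieriPila1989].
-/

namespace Literature.NumberTheory.DiophantineGeometry.Dioph

open Polynomial Finset

/-! ### Generalized Rolle theorem -/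

/-- **Generalized Rolle.** If `g` is `C^m` on an open set `U` containing `[z 0, z m]` and
vanishes at `m + 1` points `z 0 < z 1 < ⋯ < z m`, then `g^{(m)}` vanishes somewhere in
`[z 0, z m]`. [folklore] -/
theorem exists_iteratedDeriv_eq_zero {U : Set ℝ} (hU : IsOpen U) (m : ℕ) :
    ∀ (g : ℝ → ℝ), ContDiffOn ℝ m g U → ∀ (z : Fin (m + 1) → ℝ), StrictMono z →
      Set.Icc (z 0) (z (Fin.last m)) ⊆ U → (∀ i, g (z i) = 0) →
      ∃ ξ ∈ Set.Icc (z 0) (z (Fin.last m)), iteratedDeriv m g ξ = 0 := by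
  induction m with
  | zero =>
    intro g _ z _ _ h0
    exact ⟨z 0, ⟨le_rfl, le_rfl⟩, by simpa using h0 0⟩
  | succ m ih =>
    intro g hg z hz hzU h0
    have hw : ∀ i : Fin (m + 1), ∃ w ∈ Set.Ioo (z i.castSucc) (z i.succ), deriv g w = 0 := by
      intro i
      refine exists_deriv_eq_zero (hz (Fin.castSucc_lt_succ)) ?_ (by rw [h0, h0])
      refine hg.continuousOn.mono (subset_trans (Set.Icc_subset_Icc ?_ ?_) hzU)
      · exact hz.monotone (Fin.zero_le _)
      · exact hz.monotone (Fin.le_last _)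
    choose w hw hw0 using hw
    have hwmono : StrictMono w := by
      intro i j hij
      calc w i < z i.succ := (hw i).2
        _ ≤ z j.castSucc := by
            refine hz.monotone ?_
            rw [Fin.le_iff_val_le_val, Fin.val_succ, Fin.val_castSucc]
            exact Nat.succ_le_of_lt hij
        _ < w j := (hw j).1
    have hderiv : ContDiffOn ℝ m (deriv g) U := hg.deriv_of_isOpen hU (by norm_cast)
    have hw0' : z 0 ≤ w 0 := by
      have := (hw 0).1
      simpa using this.le
    have hwl : w (Fin.last m) ≤ z (Fin.last (m + 1)) := by
      have := (hw (Fin.last m)).2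
      rw [Fin.succ_last] at this
      exact this.le
    obtain ⟨ξ, hξ, hξ0⟩ := ih (deriv g) hderiv w hwmono
      ((Set.Icc_subset_Icc hw0' hwl).trans hzU) hw0
    refine ⟨ξ, ⟨hw0'.trans hξ.1, hξ.2.trans hwl⟩, ?_⟩
    rw [iteratedDeriv_succ']
    exact hξ0

/-! ### Newton coefficients (divided differences) -/

section Newton

variable (x : ℕ → ℝ) (f : ℝ → ℝ)

/-- The interpolating polynomial of `f` at the nodes `x 0, …, x k`. [folklore] -/
noncomputable def interpAt (k : ℕ) : ℝ[X] :=
  Lagrange.interpolate (Finset.range (k + 1)) x fun i => f (x i)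

/-- The `k`-th **Newton coefficient** of `f` at the nodes `x 0 < x 1 < ⋯`: the divided
difference `f[x 0, …, x k]`, i.e. the coefficient of `X^k` in the interpolating polynomial at
`x 0, …, x k`. [folklore] -/
noncomputable def newtonCoeff (k : ℕ) : ℝ := (interpAt x f k).coeff k

variable {x} (hx : StrictMono x)
include hx

/-- Strictly increasing nodes are injective. [folklore] -/
theorem injOn_nodes (s : Finset ℕ) : Set.InjOn x s := hx.injective.injOn

/-- The interpolating polynomial at `k + 1` nodes has degree `≤ k`. [folklore] -/
theorem degree_interpAt_lt (k : ℕ) : (interpAt x f k).degree < (k + 1 : ℕ) := by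
  have h := Lagrange.degree_interpolate_lt (fun i => f (x i)) (injOn_nodes hx (range (k + 1)))
  rw [card_range] at h
  exact h

/-- The interpolating polynomial at `k + 1` nodes has degree `≤ k`. [folklore] -/
theorem natDegree_interpAt_le (k : ℕ) : (interpAt x f k).natDegree ≤ k :=
  natDegree_le_iff_degree_le.2 (Order.le_of_lt_succ (by exact_mod_cast degree_interpAt_lt f hx k))

/-- The interpolating polynomial interpolates. [folklore] -/
theorem eval_interpAt {k i : ℕ} (hi : i ≤ k) : (interpAt x f k).eval (x i) = f (x i) :=
  Lagrange.eval_interpolate_at_node _ (injOn_nodes hx _) (by simpa using Nat.lt_succ_of_le hi)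

/-- **Newton's recursion** `p_{k+1} = p_k + f[x_0..x_{k+1}] · ∏_{l ≤ k} (X - x_l)`. [folklore] -/
theorem interpAt_succ (k : ℕ) : interpAt x f (k + 1) =
    interpAt x f k + C (newtonCoeff x f (k + 1)) * Lagrange.nodal (range (k + 1)) x := by
  rw [← sub_eq_iff_eq_add]
  show _ = Lagrange.interpolate (range (k + 1)) x (fun i => f (x i))
  refine Lagrange.eq_interpolate_of_eval_eq (fun i => f (x i)) (injOn_nodes hx _) ?_ ?_
  · -- degree
    rw [card_range]
    refine lt_of_le_of_lt ((degree_le_iff_coeff_zero _ k).2 fun m hm => ?_)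
      (by exact_mod_cast Nat.lt_succ_self k)
    have hm' : k < m := by exact_mod_cast hm
    rw [coeff_sub, coeff_C_mul]
    rcases Nat.lt_or_ge (k + 1) m with h | h
    · rw [coeff_eq_zero_of_natDegree_lt ((natDegree_interpAt_le f hx (k + 1)).trans_lt h),
        coeff_eq_zero_of_natDegree_lt (by rw [Lagrange.natDegree_nodal, card_range]; exact h),
        mul_zero, sub_zero]
    · have hm1 : m = k + 1 := by omega
      subst hm1
      have h1 : (Lagrange.nodal (range (k + 1)) x).coeff (k + 1) = 1 := by
        have h2 : (Lagrange.nodal (range (k + 1)) x).natDegree = k + 1 := by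
          rw [Lagrange.natDegree_nodal, card_range]
        have h3 := (Lagrange.nodal_monic (s := range (k + 1)) (v := x)).coeff_natDegree
        rwa [h2] at h3
      rw [h1, mul_one, newtonCoeff, sub_self]
  · intro i hi
    rw [mem_range] at hi
    rw [eval_sub, eval_mul, eval_C, Lagrange.eval_nodal_at_node (mem_range.2 hi), mul_zero,
      sub_zero, eval_interpAt f hx (by omega)]

/-- **Newton form** of the interpolating polynomial:
`p_k = ∑_{m ≤ k} f[x_0..x_m] ∏_{l < m} (X - x_l)`. [folklore] -/
theorem interpAt_eq_sum (k : ℕ) : interpAt x f k =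
    ∑ m ∈ range (k + 1), C (newtonCoeff x f m) * Lagrange.nodal (range m) x := by
  induction k with
  | zero =>
    rw [sum_range_one, range_zero, Lagrange.nodal_empty, mul_one]
    have h : interpAt x f 0 = C (f (x 0)) := by
      rw [interpAt, zero_add, range_one, Lagrange.interpolate_singleton]
    rw [newtonCoeff, h, coeff_C_zero]
  | succ k ih => rw [interpAt_succ f hx, ih, sum_range_succ _ (k + 1)]

/-- The values of `f` at the nodes in terms of the Newton coefficients:
`f(x_i) = ∑_{m < n} f[x_0..x_m] ∏_{l < m} (x_i - x_l)` for `i < n`. [folklore] -/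
theorem apply_node_eq_sum {n i : ℕ} (hi : i < n) :
    f (x i) = ∑ m ∈ range n, newtonCoeff x f m * ∏ l ∈ range m, (x i - x l) := by
  obtain ⟨k, rfl⟩ : ∃ k, n = k + 1 := ⟨n - 1, by omega⟩
  rw [← eval_interpAt f hx (Nat.lt_succ_iff.1 hi), interpAt_eq_sum f hx k, eval_finsetSum]
  simp only [eval_mul, eval_C, Lagrange.eval_nodal]

end Newton

/-! ### Mean value property of the Newton coefficients -/

section MeanValue

/-- Iterated derivatives of a polynomial function. [folklore] -/
theorem iteratedDeriv_eval_poly (p : ℝ[X]) (k : ℕ) :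
    iteratedDeriv k (fun t => p.eval t) = fun t => (derivative^[k] p).eval t := by
  induction k with
  | zero => simp
  | succ k ih =>
    rw [iteratedDeriv_succ, ih, Function.iterate_succ_apply']
    funext t
    exact Polynomial.deriv _

/-- The `k`-th derivative of a polynomial of degree `≤ k` is the constant `k! · a_k`.
[folklore] -/
theorem iterate_derivative_eq_C {p : ℝ[X]} {k : ℕ} (hp : p.natDegree ≤ k) :
    derivative^[k] p = C ((k.factorial : ℝ) * p.coeff k) := by
  ext m
  rw [coeff_iterate_derivative, coeff_C]
  rcases Nat.eq_zero_or_pos m with rfl | hm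
  · simp [Nat.descFactorial_self]
  · rw [if_neg hm.ne', coeff_eq_zero_of_natDegree_lt (by omega), smul_zero]

variable {x : ℕ → ℝ} (f : ℝ → ℝ) (hx : StrictMono x)
include hx

/-- **Mean value theorem for divided differences.** If `f` is `C^k` on an open set containing
`[x 0, x k]`, then `f[x 0, …, x k] = f^{(k)}(ξ) / k!` for some `ξ ∈ [x 0, x k]`. [folklore] -/
theorem exists_newtonCoeff_eq {U : Set ℝ} (hU : IsOpen U) (k : ℕ) (hf : ContDiffOn ℝ k f U)
    (hsub : Set.Icc (x 0) (x k) ⊆ U) :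
    ∃ ξ ∈ Set.Icc (x 0) (x k), iteratedDeriv k f ξ = k.factorial * newtonCoeff x f k := by
  set p := interpAt x f k with hpdef
  set g : ℝ → ℝ := fun t => f t - p.eval t with hgdef
  have hg : ContDiffOn ℝ k g U := hf.sub (Polynomial.contDiff_aeval p k).contDiffOn
  set z : Fin (k + 1) → ℝ := fun i => x i with hz
  have hzmono : StrictMono z := fun i j hij => hx hij
  have hz0 : z 0 = x 0 := rfl
  have hzl : z (Fin.last k) = x k := rfl
  obtain ⟨ξ, hξ, h0⟩ := exists_iteratedDeriv_eq_zero hU k g hg z hzmono (by rwa [hz0, hzl])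
    (fun i => by
      simp only [hgdef, hz]
      rw [eval_interpAt f hx (Nat.lt_succ_iff.1 i.2), sub_self])
  rw [hz0, hzl] at hξ
  refine ⟨ξ, hξ, ?_⟩
  have hξU : ξ ∈ U := hsub hξ
  have h1 : iteratedDeriv k g ξ = iteratedDeriv k f ξ - iteratedDeriv k (fun t => p.eval t) ξ :=
    iteratedDeriv_fun_sub (hf.contDiffAt (hU.mem_nhds hξU)) (Polynomial.contDiff_aeval p k).contDiffAt
  have h2 : iteratedDeriv k (fun t => p.eval t) ξ = k.factorial * newtonCoeff x f k := by
    rw [iteratedDeriv_eval_poly, iterate_derivative_eq_C (natDegree_interpAt_le f hx k)]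
    simp only [eval_C, newtonCoeff]
  rw [h1, h2] at h0
  linarith

/-- Bound for the Newton coefficients by the derivatives: if `|f^{(k)}| ≤ k! K` on
`[x 0, x k]` then `|f[x 0, …, x k]| ≤ K`. [folklore] -/
theorem abs_newtonCoeff_le {U : Set ℝ} (hU : IsOpen U) (k : ℕ) (hf : ContDiffOn ℝ k f U)
    (hsub : Set.Icc (x 0) (x k) ⊆ U) {K : ℝ}
    (hK : ∀ t ∈ Set.Icc (x 0) (x k), |iteratedDeriv k f t| ≤ k.factorial * K) :
    |newtonCoeff x f k| ≤ K := by
  obtain ⟨ξ, hξ, heq⟩ := exists_newtonCoeff_eq f hx hU k hf hsub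
  have h := hK ξ hξ
  rw [heq, abs_mul, Nat.abs_cast] at h
  exact le_of_mul_le_mul_left h (by positivity)

end MeanValue

/-! ### The determinant bound -/

section Determinant

variable {x : ℕ → ℝ} (hx : StrictMono x)
include hx

/-- The product `∏_i ∏_{l<i} (x_i - x_l)`, the absolute value of the Vandermonde determinant of
increasing nodes. [folklore] -/
theorem prod_prod_sub_pos (n : ℕ) : 0 < ∏ i : Fin n, ∏ l ∈ range i, (x i - x l) :=
  prod_pos fun _ _ => prod_pos fun _ hl => sub_pos.2 (hx (mem_range.1 hl))

/-- **Generalized mean value bound for interpolation determinants** (Bombieri–Pila (1),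
Schwarz, Swinnerton-Dyer Lemma 1). Let `x 0 < ⋯ < x (n-1)` lie in an open set `U` together
with `[x 0, x (n-1)]`, and let `f j` (`j < n`) be functions with `f j ∈ C^m(U)` for `m < n` and
`|f_j^{(m)}(t)| ≤ m! K m j` for `t ∈ [x 0, x m]`, for all `m < n` (note: only on the initial
segment `[x 0, x m]`, which is weaker than asking it on all of `[x 0, x (n-1)]` as in the usual
statement of formula (1); the conclusion is the same). Then
`|det (f j (x i))| ≤ ∏_i ∏_{l<i} (x_i - x_l) · ∑_σ ∏_i K (σ i) i`.
Proof: `(f j (x i)) = L · D` with `L i m = ∏_{l<m} (x_i - x_l)` lower triangular of determinant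
`∏_i ∏_{l<i} (x_i - x_l)` and `D m j = f_j[x_0..x_m]` (Newton form), and `|D m j| ≤ K m j`
(mean value theorem for divided differences). [cite: BombieriPila1989, formula (1)] -/
theorem abs_det_le {n : ℕ} {U : Set ℝ} (hU : IsOpen U) (hsub : Set.Icc (x 0) (x (n - 1)) ⊆ U)
    (f : Fin n → ℝ → ℝ) (hf : ∀ j (m : ℕ), m < n → ContDiffOn ℝ m (f j) U)
    (K : ℕ → Fin n → ℝ)
    (hK : ∀ j (m : ℕ), m < n → ∀ t ∈ Set.Icc (x 0) (x m),
      |iteratedDeriv m (f j) t| ≤ m.factorial * K m j) :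
    |(Matrix.of fun i j : Fin n => f j (x i)).det| ≤
      (∏ i : Fin n, ∏ l ∈ range i, (x i - x l)) * ∑ σ : Equiv.Perm (Fin n), ∏ i, K (σ i) i := by
  set L : Matrix (Fin n) (Fin n) ℝ := Matrix.of fun i m => ∏ l ∈ range m, (x i - x l) with hL
  set D : Matrix (Fin n) (Fin n) ℝ := Matrix.of fun m j => newtonCoeff x (f j) m with hD
  have hA : (Matrix.of fun i j : Fin n => f j (x i)) = L * D := by
    ext i j
    rw [Matrix.mul_apply, Matrix.of_apply]
    simp only [hL, hD, Matrix.of_apply]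
    rw [apply_node_eq_sum (f j) hx i.2]
    rw [← Fin.sum_univ_eq_sum_range (fun m => newtonCoeff x (f j) m * ∏ l ∈ range m, (x i - x l))]
    exact Finset.sum_congr rfl fun m _ => mul_comm _ _
  have hLdet : L.det = ∏ i : Fin n, ∏ l ∈ range i, (x i - x l) := by
    rw [Matrix.det_of_lowerTriangular L ?_]
    · simp [hL]
    · intro i j hij
      simp only [hL, Matrix.of_apply]
      exact prod_eq_zero (mem_range.2 hij) (sub_self _)
  have hDbound : ∀ m j : Fin n, |D m j| ≤ K m j := by
    intro m j
    simp only [hD, Matrix.of_apply]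
    have hm : (m : ℕ) < n := m.2
    refine abs_newtonCoeff_le (f j) hx hU m (hf j m hm) ((Set.Icc_subset_Icc le_rfl ?_).trans hsub)
      (hK j m hm)
    exact hx.monotone (by omega)
  have hDdet : |D.det| ≤ ∑ σ : Equiv.Perm (Fin n), ∏ i, K (σ i) i := by
    rw [Matrix.det_apply']
    refine (abs_sum_le_sum_abs _ _).trans (sum_le_sum fun σ _ => ?_)
    rw [abs_mul]
    have hsign : |((Equiv.Perm.sign σ : ℤ) : ℝ)| = 1 := by
      rcases Int.units_eq_one_or (Equiv.Perm.sign σ) with h | h <;> simp [h]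
    rw [hsign, one_mul, Finset.abs_prod]
    exact prod_le_prod (fun i _ => abs_nonneg _) fun i _ => hDbound _ _
  rw [hA, Matrix.det_mul, hLdet, abs_mul, abs_of_pos (prod_prod_sub_pos hx n)]
  exact mul_le_mul_of_nonneg_left hDdet (prod_prod_sub_pos hx n).le

end Determinant

end Literature.NumberTheory.DiophantineGeometry.Dioph
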